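import Summits.HodgeConjecture.CorCM.MumfordTateRankSevenQuaternionDefinite
import Summits.HodgeConjecture.CorCM.MumfordTateRankTypeThreeLefschetz
import Literature.Algebra.Lie.KillingSubalgebraSmallCodimension
import Literature.Algebra.Lie.SemisimpleDimensionEight
import Mathlib.Algebra.Lie.SkewAdjoint
import HarnessLib

/-!
# Type II fourfolds over `ℚ`: `dim MT(H¹B) = 11` and `Lie Hg(H¹B) = C(End⁰B) ∩ 𝔰𝔭(H¹B, ψ)` — Hodge = Lefschetz for every simple
# quaternion fourfold over `ℚ` (Moonen–Zarhin Thm. (0.1) (2), (4) at the level of Lie algebras)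

COR-CM (cell `pub-hodgecm2`, seat `b27` gen 45, count-neutral Mumford–Tate-rank ladder; theorems only, no definition, no named
fact; UNCONDITIONAL — nothing here uses or asserts HC_CM).  Sequel of `CorCM/MumfordTateRankSevenQuaternionDefinite` (a simple
fourfold `B` with totally INDEFINITE quaternion multiplication over `ℚ` has `dim MT(H¹B) ∈ {9, 10, 11}`) and companion of
`CorCM/MumfordTateRankTypeThreeLefschetz` (totally DEFINITE: `Lie Hg = C(End_Hdg) ∩ 𝔰𝔭`, `t = 7`).  The values `9` and `10` are
excluded by Lie theory (`Literature/Algebra/Lie/KillingSubalgebraSmallCodimension`, `…/SemisimpleDimensionEight`): `𝔥 = Lie Hg(H¹B)`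
is semisimple (`𝔷 = 0`) inside the Lefschetz Lie algebra `L = C(i, j) ∩ 𝔰𝔭(ψ)` of the Rosati pair `i† = -i`, `j† = +j`
(dimension `10`), with trivial centraliser `C_L(𝔥) ⊆ Z(End_Hdg) ∩ 𝔰𝔭 = 0`; a semisimple subalgebra of codimension `1` (perfect)
or of dimension `8` and codimension `2` (then SIMPLE, and `2² < 8`) is normalised by `L`, and a normalised Killing subalgebra with
trivial centraliser is everything (all its derivations are inner): `L = 𝔥`, contradicting `dim 𝔥 ∈ {8, 9}`.

* **`mtRank_hodge_one_eq_eleven_of_isSimple_fourfold_of_isTotallyIndefinite`** — `B` simple, `dim B = 4`, `End⁰B` a totally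
  indefinite quaternion algebra over `ℚ` ⟹ **`dim MT(H¹B) = 11`** (Moonen–Zarhin Thm. (0.1) (4): `Hg = Sp_D(V, φ)`, of dimension
  `10`).
* **`hodgeLie_hodge_one_eq_centralizer_inf_skewAdjoint_of_isTotallyIndefinite`** — then `Lie Hg(H¹B) = C(End_Hdg H¹B) ∩ 𝔰𝔭(H¹B, ψ)`
  for every polarization `ψ`.
* **`mtRank_hodge_one_eq_seven_or_eleven_of_isSimple_quaternion_fourfold`**,
  **`hodgeLie_hodge_one_eq_centralizer_inf_skewAdjoint_of_isSimple_quaternion_fourfold`** — for EVERY simple abelian fourfold whose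
  endomorphism algebra is a quaternion algebra over `ℚ`: `dim MT(H¹B) = 7` (definite) or `11` (indefinite), and in both cases
  the Hodge Lie algebra IS the Lefschetz Lie algebra.

## References
* [MoonenZarhin1999LowDim] B. Moonen, Yu. Zarhin, Math. Ann. 315 (1999), Thm. (0.1) (2), (4), §1 (`Hg(X) ⊂ Sp_D(V, φ)`), §2.
* [Humphreys1972] J. E. Humphreys, GTM 9 (1972), §5.2, §5.3 (derivations of a semisimple Lie algebra are inner), §8.4.
* [Milne1999LefschetzClasses] J. S. Milne, Duke Math. J. 96 (1999), §2 (types II, III) and Summary.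
* [Lange2023AbelianVarietiesComplex] H. Lange, *Abelian Varieties over the Complex Numbers* (2023), §2.6.2 Thm. 2.6.5 (b).
-/

noncomputable section

open scoped TensorProduct Quaternion
open CategoryTheory CategoryTheory.Limits Module

namespace Summit.HodgeConjecture.CorCM

open Literature.AlgebraicGeometry.Motives
open Literature.AlgebraicGeometry.Motives.AbelianVariety
open Literature.AlgebraicGeometry.Motives.HodgeStructure
open Literature.AlgebraicGeometry.HodgeTheory
open Literature.AlgebraicGeometry.Milne1999 (IsOfCMType)
open Literature.NumberTheory.Automorphic (IsQuaternionAlgebra IsTotallyDefinite)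
open Literature.RingTheory.CentralSimple
open Literature.Algebra.Lie

variable [HodgeTensorFacts.{0, 0}]

/-! ## §1 Type II fourfolds over `ℚ`: `dim MT(H¹B) = 11` -/

/-- **A simple abelian FOURFOLD `B` with totally INDEFINITE quaternion multiplication over `ℚ` (type II, `m = 2`) has
`dim MT(H¹B) = 11`** — Moonen–Zarhin Thm. (0.1) (4), «`Hg(X) = Sp_D(V, φ)`».  By `CorCM/MumfordTateRankSevenQuaternionDefinite`
`t ∈ {9, 10, 11}`; `𝔥 = Lie Hg(H¹B)` (semisimple, `𝔷 = 0`) lies in the Lefschetz Lie algebra `L = C(i, j) ∩ 𝔰𝔭(ψ)` of the Rosati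
pair (dimension `10`) with `C_L(𝔥) ⊆ ℚ · 1 ∩ 𝔰𝔭 = 0` (the commutant of `Lie Hg` is `End_Hdg`, whose centraliser of `i, j` is
`ℚ`); at `t = 10` (`dim 𝔥 = 9`, codimension `1`, `𝔥` perfect) and at `t = 9` (`dim 𝔥 = 8`, so `𝔥` SIMPLE, codimension `2`,
`2² < 8`) the subalgebra `𝔥` is normalised by `L`, hence `L = 𝔥` since all derivations of `𝔥` are inner — a contradiction.
[cite: MoonenZarhin1999LowDim, Thm. (0.1) (4) and §1] [cite: Humphreys1972, §5.3 Theorem] -/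
theorem mtRank_hodge_one_eq_eleven_of_isSimple_fourfold_of_isTotallyIndefinite {B : AbelianVariety ℂ} {k : ℕ}
    (hB : IsSmoothProjective k B.X) (hBs : B.IsSimple) (hB4 : B.dim = 4) [IsQuaternionAlgebra ℚ B.endAlgebra]
    (hind : IsTotallyIndefinite ℚ B.endAlgebra) :
    haveI := BettiUniverse.finite hB 1
    (BettiUniverse.hodge exists_isReal_hodgeModel_holds hB 1).mtRank = 11 := by
  classical
  have hk : B.dim = k := schemeDim_eq_holds hB
  subst hk
  haveI := BettiUniverse.finite hB 1
  letI : LieRing (Module.End ℚ (bettiCohomology B.X 1)) := LieRing.ofAssociativeRing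
  rcases mtRank_hodge_one_mem_of_isSimple_fourfold_of_isTotallyIndefinite' hB hBs hB4 hind with ht9 | ht10 | ht11
  rotate_right
  · exact ht11
  all_goals exfalso
  all_goals
    set H := BettiUniverse.hodge exists_isReal_hodgeModel_holds hB 1 with hH
    have hB0 : 0 < B.dim := by omega
    have hdimV : Module.finrank ℚ (bettiCohomology B.X 1) = 8 := by rw [finrank_bettiCohomology_one_eq_two_mul_dim B, hB4]
    obtain ⟨-, -, hz, -⟩ := mtRank_hodge_one_mem_of_isSimple_fourfold_of_isTotallyIndefinite hB hBs hB4 hind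
    have ht := mtRank_hodge_one_eq_finrank_hodgeLie_add_one hB hB0
    change H.mtRank = Module.finrank ℚ H.hodgeLie + 1 at ht
    have hspan := hodgeLie_hodge_one_center_sup_derived hB
    rw [hz, bot_sup_eq] at hspan
    change Submodule.span ℚ {B' | ∃ X' ∈ H.hodgeLie, ∃ Y ∈ H.hodgeLie, X' * Y - Y * X' = B'} = H.hodgeLie at hspan
    -- the Rosati pair and the Lefschetz Lie algebra `L = C(i, j) ∩ 𝔰𝔭(ψ)`, of dimension `10`
    obtain ⟨ψ⟩ := BettiUniverse.hodge_isPolarizable exists_isReal_hodgeModel_holds hB 1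
    obtain ⟨a, b, i, j, ha, hb, hi, hj, hij, hiA, hjA, hτi, hτj⟩ := exists_quaternion_pair_of_isTotallyIndefinite hB hBs hind ψ
    have hflip : ψ.form.flip = -ψ.form := by
      rw [ψ.flip_form, show (((1 : ℕ) : ℤ).negOnePow : ℤˣ) = -1 from Int.negOnePow_one, Units.val_neg, Units.val_one,
        neg_one_zsmul]
    have hcount := finrank_centralizer_inf_skewAdjoint_eq_orth ψ hflip ha hb hi hj hij hτi hτj
    rw [hdimV] at hcount
    have hL10 : Module.finrank ℚ ↥(Subalgebra.toSubmodule (Subalgebra.centralizer ℚ ({i, j} : Set (Module.End ℚ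
        (bettiCohomology B.X 1)))) ⊓ ψ.form.skewAdjointSubmodule) = 10 := by omega
    obtain ⟨L, hL⟩ : ∃ L : LieSubalgebra ℚ (Module.End ℚ (bettiCohomology B.X 1)), L.toSubmodule =
        Subalgebra.toSubmodule (Subalgebra.centralizer ℚ ({i, j} : Set (Module.End ℚ (bettiCohomology B.X 1)))) ⊓
          ψ.form.skewAdjointSubmodule :=
      ⟨{ (Subalgebra.toSubmodule (Subalgebra.centralizer ℚ ({i, j} : Set (Module.End ℚ (bettiCohomology B.X 1)))) ⊓
            ψ.form.skewAdjointSubmodule) with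
          lie_mem' := fun {Y Z} hY hZ => by
            obtain ⟨hYc, hYs⟩ := Submodule.mem_inf.1 hY
            obtain ⟨hZc, hZs⟩ := Submodule.mem_inf.1 hZ
            refine Submodule.mem_inf.2 ⟨?_, ψ.form.isSkewAdjoint_bracket hYs hZs⟩
            rw [Subalgebra.mem_toSubmodule] at hYc hZc ⊢
            rw [LieRing.of_associative_ring_bracket]
            exact Subalgebra.sub_mem _ (Subalgebra.mul_mem _ hYc hZc) (Subalgebra.mul_mem _ hZc hYc) }, rfl⟩
    -- `𝔥` as a Lie subalgebra, `𝔥 ≤ L`, Killing (and semisimple)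
    obtain ⟨𝔏, h𝔏⟩ : ∃ 𝔏 : LieSubalgebra ℚ (Module.End ℚ (bettiCohomology B.X 1)), 𝔏.toSubmodule = H.hodgeLie :=
      ⟨{ H.hodgeLie with
          lie_mem' := fun {Y Z} hY hZ => by
            rw [LieRing.of_associative_ring_bracket]
            exact H.commutator_mem_hodgeLie hY hZ }, rfl⟩
    have hmem𝔏 : ∀ Y, Y ∈ 𝔏 ↔ Y ∈ H.hodgeLie := fun Y => by rw [← LieSubalgebra.mem_toSubmodule, h𝔏]
    have hmemL : ∀ Y, Y ∈ L ↔ (Y * i = i * Y ∧ Y * j = j * Y) ∧ Y ∈ ψ.form.skewAdjointSubmodule := fun Y => by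
      rw [← LieSubalgebra.mem_toSubmodule, hL, Submodule.mem_inf, Subalgebra.mem_toSubmodule, Subalgebra.mem_centralizer_iff]
      simp only [Set.mem_insert_iff, Set.mem_singleton_iff, forall_eq_or_imp, forall_eq]
      exact ⟨fun ⟨⟨h1, h2⟩, h3⟩ => ⟨⟨h1.symm, h2.symm⟩, h3⟩, fun ⟨⟨h1, h2⟩, h3⟩ => ⟨⟨h1.symm, h2.symm⟩, h3⟩⟩
    have hle : 𝔏 ≤ L := by
      intro Y hY
      rw [hmem𝔏] at hY
      rw [hmemL]
      refine ⟨⟨commute_of_mem_hodgeLie H hY ⟨_, hiA⟩, commute_of_mem_hodgeLie H hY ⟨_, hjA⟩⟩, ?_⟩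
      rw [LinearMap.mem_skewAdjointSubmodule]
      intro v w
      rw [Pi.neg_apply, map_neg, ← add_eq_zero_iff_eq_neg]
      exact form_apply_add_eq_zero_of_mem_hodgeLie ψ hY v w
    haveI : Module.Finite ℚ 𝔏 := Module.Finite.of_injective 𝔏.toSubmodule.subtype Subtype.val_injective
    haveI : Module.Finite ℚ L := Module.Finite.of_injective L.toSubmodule.subtype Subtype.val_injective
    haveI : LieAlgebra.IsKilling ℚ 𝔏 :=
      isKilling_of_eq_hodgeLie_derived H (by simp) (BettiUniverse.hodge_isEffective _ hB 1) ψ 𝔏 (by rw [h𝔏, hspan])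
    haveI : LieAlgebra.IsSemisimple ℚ 𝔏 := (isSemisimple_of_eq_hodgeLie_hodge_one_derived hB 𝔏 (by rw [h𝔏, hspan])).1
    have hdim𝔏 : Module.finrank ℚ 𝔏 = Module.finrank ℚ H.hodgeLie := by rw [← h𝔏]; rfl
    have hdimL : Module.finrank ℚ L = 10 := by rw [← hL10, ← hL]; rfl
    -- `C_L(𝔥) = 0`
    have hcent : ∀ x ∈ L, (∀ h ∈ 𝔏, ⁅x, h⁆ = 0) → x = 0 := by
      intro x hx hxc
      obtain ⟨⟨hxi, hxj⟩, hxs⟩ := (hmemL x).1 hx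
      -- `x` commutes with `Lie Hg`, hence is a Hodge endomorphism
      have hxA : x ∈ H.endAlg := mem_endAlg_of_forall_commute H fun Y hY => by
        have h0 := hxc Y ((hmem𝔏 Y).2 hY)
        rw [LieRing.of_associative_ring_bracket, sub_eq_zero] at h0
        exact h0
      -- `C_{End_Hdg}(i, j) = ℚ · 1` (`dim End_Hdg = 4 · dim C`)
      have hE4 : Module.finrank ℚ H.endAlg = 4 := by
        rw [← finrank_endAlgebra_eq_finrank_endAlg hB]
        exact IsQuaternionAlgebra.finrank_eq_four (K := ℚ) (D := B.endAlgebra)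
      haveI : Nontrivial H.endAlg := Module.nontrivial_of_finrank_pos (R := ℚ) (by rw [hE4]; norm_num)
      have hi' : (⟨i, hiA⟩ : H.endAlg) * ⟨i, hiA⟩ = algebraMap ℚ H.endAlg a := Subtype.ext hi
      have hj' : (⟨j, hjA⟩ : H.endAlg) * ⟨j, hjA⟩ = algebraMap ℚ H.endAlg b := Subtype.ext hj
      have hij' : (⟨i, hiA⟩ : H.endAlg) * ⟨j, hjA⟩ = -(⟨j, hjA⟩ * ⟨i, hiA⟩) := Subtype.ext hij
      have h4C := QuaternionCentralizer.finrank_eq_four_mul_finrank_centralizer (K := ℚ) (E := H.endAlg) ha hb hi' hj' hij'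
      rw [hE4] at h4C
      have hC1 : Module.finrank ℚ ↥(Subalgebra.toSubmodule (Subalgebra.centralizer ℚ
          ({⟨i, hiA⟩, ⟨j, hjA⟩} : Set H.endAlg))) = 1 := by omega
      have hbot : Subalgebra.centralizer ℚ ({⟨i, hiA⟩, ⟨j, hjA⟩} : Set H.endAlg) = ⊥ := by
        refine Subalgebra.eq_of_le_of_finrank_le bot_le ?_ |>.symm
        rw [Subalgebra.finrank_bot, ← Subalgebra.finrank_toSubmodule, hC1]
      have hxC : (⟨x, hxA⟩ : H.endAlg) ∈ Subalgebra.centralizer ℚ ({⟨i, hiA⟩, ⟨j, hjA⟩} : Set H.endAlg) := by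
        rw [Subalgebra.mem_centralizer_iff]
        intro g hg
        simp only [Set.mem_insert_iff, Set.mem_singleton_iff] at hg
        rcases hg with rfl | rfl
        · exact Subtype.ext hxi.symm
        · exact Subtype.ext hxj.symm
      rw [hbot, Algebra.mem_bot] at hxC
      obtain ⟨q, hq⟩ := Set.mem_range.1 hxC
      have hxq : x = q • (1 : Module.End ℚ (bettiCohomology B.X 1)) := by
        have h1 := congrArg Subtype.val hq
        rw [Algebra.algebraMap_eq_smul_one] at h1
        exact h1.symm
      -- a `ψ`-skew rational scalar vanishes
      haveI : Nontrivial (bettiCohomology B.X 1) := Module.nontrivial_of_finrank_pos (R := ℚ) (by rw [hdimV]; norm_num)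
      obtain ⟨v, hv⟩ := exists_ne (0 : bettiCohomology B.X 1)
      obtain ⟨w, hw⟩ : ∃ w, ψ.form v w ≠ 0 := by
        by_contra hcon
        push Not at hcon
        exact hv (ψ.nondegenerate.1 v hcon)
      rw [LinearMap.mem_skewAdjointSubmodule] at hxs
      have h2 := hxs v w
      simp only [hxq, Pi.neg_apply, LinearMap.smul_apply, Module.End.one_apply, map_smul, map_neg, smul_eq_mul] at h2
      have h3 : (2 * q) * ψ.form v w = 0 := by linear_combination h2
      have hq0 : q = 0 := by
        rcases mul_eq_zero.1 h3 with h3 | h3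
        · exact (mul_eq_zero.1 h3).resolve_left two_ne_zero
        · exact absurd h3 hw
      rw [hxq, hq0, zero_smul]
    -- `[L, 𝔥] ⊆ 𝔥`: codimension one (`𝔥` perfect) at `t = 10`, simple of dimension `8` in codimension two at `t = 9`
    have hideal : ∀ x ∈ L, ∀ h ∈ 𝔏, ⁅x, h⁆ ∈ 𝔏 := by
      first
      | -- `t = 9`
        have h8 : Module.finrank ℚ 𝔏 = 8 := by rw [hdim𝔏]; change H.mtRank = 9 at ht9; omega
        haveI : LieAlgebra.IsSimple ℚ 𝔏 := SemisimpleSmallDimension.isSimple_of_finrank_eq_eight h8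
        exact KillingCodimension.lie_mem_of_isSimple_of_sq_lt_finrank 𝔏 L hle (by rw [hdimL, h8]; norm_num)
      | -- `t = 10`
        have h9 : Module.finrank ℚ 𝔏 = 9 := by rw [hdim𝔏]; change H.mtRank = 10 at ht10; omega
        exact KillingCodimension.lie_mem_of_finrank_le_succ_of_perfect 𝔏 L hle (by omega) (by
          rw [h𝔏, ← hspan]
          refine Submodule.span_mono ?_
          rintro B' ⟨X', hX', Y, hY, rfl⟩
          exact ⟨X', (hmem𝔏 X').2 hX', Y, (hmem𝔏 Y).2 hY, by rw [LieRing.of_associative_ring_bracket]⟩)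
    have hEq := KillingCodimension.eq_of_isKilling_of_forall_lie_mem_of_centralizer 𝔏 L hle hideal hcent
    have hfin : Module.finrank ℚ L = Module.finrank ℚ 𝔏 := by rw [hEq]
    rw [hdimL, hdim𝔏] at hfin
    first
    | change H.mtRank = 9 at ht9; omega
    | change H.mtRank = 10 at ht10; omega

/-! ## §2 Hodge = Lefschetz for type II fourfolds over `ℚ` -/

/-- **`Lie Hg(H¹B) = C_{End H¹B}(End_Hdg H¹B) ∩ 𝔰𝔭(H¹B, ψ)` for a simple abelian FOURFOLD with totally indefinite quaternion
multiplication over `ℚ`** and every polarization `ψ`: `⊆` always; the right side lies in `C(i, j) ∩ 𝔰𝔭(ψ)` of dimension `10`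
(`CorCM/MumfordTateRankTypeTwoLefschetz` §2) and the left side has dimension `10` (§1) — Moonen–Zarhin Thm. (0.1) (4)
«`Hg(X) = Sp_D(V, φ)`» at the level of Lie algebras. [cite: MoonenZarhin1999LowDim, Thm. (0.1) (4) and §1]
[cite: Milne1999LefschetzClasses, §2 (type II) and Summary] -/
theorem hodgeLie_hodge_one_eq_centralizer_inf_skewAdjoint_of_isTotallyIndefinite {B : AbelianVariety ℂ} {k : ℕ}
    (hB : IsSmoothProjective k B.X) (hBs : B.IsSimple) (hB4 : B.dim = 4) [IsQuaternionAlgebra ℚ B.endAlgebra]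
    (hind : IsTotallyIndefinite ℚ B.endAlgebra) [Module.Finite ℚ (bettiCohomology B.X 1)]
    (ψ : (BettiUniverse.hodge exists_isReal_hodgeModel_holds hB 1).Polarization) :
    (BettiUniverse.hodge exists_isReal_hodgeModel_holds hB 1).hodgeLie =
      Subalgebra.toSubmodule (Subalgebra.centralizer ℚ
          ((BettiUniverse.hodge exists_isReal_hodgeModel_holds hB 1).endAlg : Set (Module.End ℚ (bettiCohomology B.X 1)))) ⊓
        ψ.form.skewAdjointSubmodule := by
  classical
  have hk : B.dim = k := schemeDim_eq_holds hB
  obtain ⟨a, b, i, j, ha, hb, hi, hj, hij, hiA, hjA, hτi, hτj⟩ := exists_quaternion_pair_of_isTotallyIndefinite hB hBs hind ψ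
  -- `⊆`
  have hle : (BettiUniverse.hodge exists_isReal_hodgeModel_holds hB 1).hodgeLie ≤
      Subalgebra.toSubmodule (Subalgebra.centralizer ℚ
        ((BettiUniverse.hodge exists_isReal_hodgeModel_holds hB 1).endAlg : Set (Module.End ℚ (bettiCohomology B.X 1))))
      ⊓ ψ.form.skewAdjointSubmodule := by
    intro Y hY
    refine Submodule.mem_inf.2 ⟨?_, ?_⟩
    · rw [Subalgebra.mem_toSubmodule, Subalgebra.mem_centralizer_iff]
      intro g hg
      exact (commute_of_mem_hodgeLie _ hY ⟨g, hg⟩).symm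
    · rw [LinearMap.mem_skewAdjointSubmodule]
      intro v w
      rw [Pi.neg_apply, map_neg, ← add_eq_zero_iff_eq_neg]
      exact form_apply_add_eq_zero_of_mem_hodgeLie ψ hY v w
  -- the Lefschetz Lie algebra lies in `C(i, j) ∩ 𝔰𝔭(ψ)`, of dimension `10`
  have hle' : Subalgebra.toSubmodule (Subalgebra.centralizer ℚ
        ((BettiUniverse.hodge exists_isReal_hodgeModel_holds hB 1).endAlg : Set (Module.End ℚ (bettiCohomology B.X 1))))
      ⊓ ψ.form.skewAdjointSubmodule ≤ Subalgebra.toSubmodule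
      (Subalgebra.centralizer ℚ ({i, j} : Set (Module.End ℚ (bettiCohomology B.X 1)))) ⊓ ψ.form.skewAdjointSubmodule := by
    refine inf_le_inf_right _ fun Y hY => ?_
    rw [Subalgebra.mem_toSubmodule] at hY ⊢
    refine Subalgebra.centralizer_le ℚ _ _ ?_ hY
    intro g hg
    simp only [Set.mem_insert_iff, Set.mem_singleton_iff] at hg
    rcases hg with rfl | rfl
    · exact hiA
    · exact hjA
  have hflip : ψ.form.flip = -ψ.form := by
    rw [ψ.flip_form, show (((1 : ℕ) : ℤ).negOnePow : ℤˣ) = -1 from Int.negOnePow_one, Units.val_neg, Units.val_one,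
      neg_one_zsmul]
  have hcount := finrank_centralizer_inf_skewAdjoint_eq_orth ψ hflip ha hb hi hj hij hτi hτj
  have hdimV : Module.finrank ℚ (bettiCohomology B.X 1) = 8 := by rw [finrank_bettiCohomology_one_eq_two_mul_dim B, hB4]
  rw [hdimV] at hcount
  -- `dim Lie Hg = 10`
  have h11 := mtRank_hodge_one_eq_eleven_of_isSimple_fourfold_of_isTotallyIndefinite hB hBs hB4 hind
  have ht := mtRank_hodge_one_eq_finrank_hodgeLie_add_one hB (by omega)
  have h10 : Module.finrank ℚ (BettiUniverse.hodge exists_isReal_hodgeModel_holds hB 1).hodgeLie = 10 := by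
    change (BettiUniverse.hodge exists_isReal_hodgeModel_holds hB 1).mtRank = 11 at h11
    change (BettiUniverse.hodge exists_isReal_hodgeModel_holds hB 1).mtRank =
      Module.finrank ℚ (BettiUniverse.hodge exists_isReal_hodgeModel_holds hB 1).hodgeLie + 1 at ht
    omega
  refine Submodule.eq_of_le_of_finrank_le hle ?_
  have hfin := Submodule.finrank_mono hle'
  omega

/-! ## §3 Every simple quaternion fourfold over `ℚ`: `t ∈ {7, 11}`, Hodge = Lefschetz -/

omit [HodgeTensorFacts.{0, 0}] in
/-- Over `ℚ` a quaternion algebra is totally definite or totally indefinite (one infinite place). [folklore] -/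
private theorem isTotallyDefinite_or_isTotallyIndefinite_rat' (D : Type) [Ring D] [Algebra ℚ D] :
    IsTotallyDefinite ℚ D ∨ Literature.RingTheory.CentralSimple.IsTotallyIndefinite ℚ D := by
  by_cases h : Literature.NumberTheory.Automorphic.IsSplitAtInfinite D Rat.infinitePlace
  · exact Or.inr ⟨fun w => by rwa [Subsingleton.elim w Rat.infinitePlace]⟩
  · exact Or.inl fun w => by rwa [Subsingleton.elim w Rat.infinitePlace]

/-- **Every simple complex abelian FOURFOLD whose endomorphism algebra is a quaternion algebra over `ℚ` has `dim MT(H¹B) = 7`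
(totally definite, type III) or `dim MT(H¹B) = 11` (totally indefinite, type II)** — Moonen–Zarhin Thm. (0.1) (2), (4).
[cite: MoonenZarhin1999LowDim, Thm. (0.1) (2), (4)] -/
theorem mtRank_hodge_one_eq_seven_or_eleven_of_isSimple_quaternion_fourfold {B : AbelianVariety ℂ} {k : ℕ}
    (hB : IsSmoothProjective k B.X) (hBs : B.IsSimple) (hB4 : B.dim = 4) [IsQuaternionAlgebra ℚ B.endAlgebra] :
    haveI := BettiUniverse.finite hB 1
    (IsTotallyDefinite ℚ B.endAlgebra ∧ (BettiUniverse.hodge exists_isReal_hodgeModel_holds hB 1).mtRank = 7) ∨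
      (Literature.RingTheory.CentralSimple.IsTotallyIndefinite ℚ B.endAlgebra ∧
        (BettiUniverse.hodge exists_isReal_hodgeModel_holds hB 1).mtRank = 11) := by
  rcases isTotallyDefinite_or_isTotallyIndefinite_rat' B.endAlgebra with hdef | hind
  · exact Or.inl ⟨hdef, (mtRank_hodge_one_eq_seven_of_isSimple_fourfold_of_isTotallyDefinite hB hBs hB4 hdef).1⟩
  · exact Or.inr ⟨hind, mtRank_hodge_one_eq_eleven_of_isSimple_fourfold_of_isTotallyIndefinite hB hBs hB4 hind⟩

/-- **HODGE = LEFSCHETZ for every simple quaternion fourfold over `ℚ`**: for a simple complex abelian fourfold `B` whose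
endomorphism algebra is a quaternion algebra over `ℚ` and every polarization `ψ` of `H¹B`,
**`Lie Hg(H¹B) = C_{End H¹B}(End_Hdg H¹B) ∩ 𝔰𝔭(H¹B, ψ)`** — the Hodge group is the Lefschetz group at the level of Lie algebras,
in the definite case by `CorCM/MumfordTateRankTypeThreeLefschetz` (Thm. (0.1) (2)) and in the indefinite case by §2 (Thm. (0.1) (4)).
[cite: MoonenZarhin1999LowDim, Thm. (0.1) (2), (4) and §1] [cite: Milne1999LefschetzClasses, §2 (types II, III) and Summary] -/
theorem hodgeLie_hodge_one_eq_centralizer_inf_skewAdjoint_of_isSimple_quaternion_fourfold {B : AbelianVariety ℂ} {k : ℕ}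
    (hB : IsSmoothProjective k B.X) (hBs : B.IsSimple) (hB4 : B.dim = 4) [IsQuaternionAlgebra ℚ B.endAlgebra]
    [Module.Finite ℚ (bettiCohomology B.X 1)] (ψ : (BettiUniverse.hodge exists_isReal_hodgeModel_holds hB 1).Polarization) :
    (BettiUniverse.hodge exists_isReal_hodgeModel_holds hB 1).hodgeLie =
      Subalgebra.toSubmodule (Subalgebra.centralizer ℚ
          ((BettiUniverse.hodge exists_isReal_hodgeModel_holds hB 1).endAlg : Set (Module.End ℚ (bettiCohomology B.X 1)))) ⊓
        ψ.form.skewAdjointSubmodule := by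
  rcases isTotallyDefinite_or_isTotallyIndefinite_rat' B.endAlgebra with hdef | hind
  · exact hodgeLie_hodge_one_eq_centralizer_inf_skewAdjoint_of_fourfold hB hBs hB4 hdef ψ
  · exact hodgeLie_hodge_one_eq_centralizer_inf_skewAdjoint_of_isTotallyIndefinite hB hBs hB4 hind ψ

end Summit.HodgeConjecture.CorCM

end
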